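import Summits.AtomisticToContinuum.HydrodynamicLimit.Theorems.DensityCap.Negative.MollifiedDensity
import Mathlib.MeasureTheory.Constructions.HaarToSphere
import Mathlib.MeasureTheory.Measure.Lebesgue.VolumeOfBalls
import Mathlib.MeasureTheory.Integral.IntervalIntegral.Periodic

/-!
# The cone kernel of the crux `DensityCap` is a probability density on `𝕋³`: `coneMass r = 1` for `r ≤ 1/2`

Negative-side structure for the crux `JParityClosure.DensityCap` (stmt-AtomisticToContinuum-13082), from the standing
disprover's `Cruxes/DensityCap/Disproof.lean` §2b (cycle 1). The crux mollifies the empirical density with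
`b_r(x,y) = 3/(πr³)(1 − d(x,y)/r)₊` (`DensityCapNegative.cone`); here its Haar mass is computed:
* `integral_coneR3` — on `ℝ³`, `∫ 3/(πr³)(1 − |v|/r)₊ dv = 1` (radial reduction `integral_fun_norm_addHaar`,
  `volume_ball_fin_three`, the elementary `∫₀ʳ y²(1 − y/r) dy = r³/12`);
* `coneMass_eq_one` — on `𝕋³`, `DensityCapNegative.coneMass r = 1` for `0 < r ≤ 1/2` (torus → fundamental cube by the
  measure-preserving covering map `coverMap`, `measurePreserving_pi` + `UnitAddCircle.measurePreserving_mk`; cube → `ℝ³` since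
  the kernel of radius `≤ 1/2` vanishes off the cube; `Fin 3 → ℝ` versus `EuclideanSpace` by `PiLp.volume_preserving_toLp`);
* `exists_one_le_mollDensity` — the sharp first-moment point: every configuration of `n ≥ 1` particles has a centre of
  mollified density `≥ 1` (average exactly the mass `1`).
This is the kernel-normalisation brick of the corollary proof `HydrodynamicLimit → DensityCap`
(`∫ b_r(y,x) ρ(s,y) dy ≤ ρ(s,x) + osc_{B_r(x)} ρ(s,·)`), recorded in the disproof's near-miss docstring.
refuter-cdisprove-stmt-AtomisticToContinuum-13082-0.
-/

noncomputable section

namespace Summit.AtomisticToContinuum.HydrodynamicLimit.Theorems.DensityCapNegative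

open MeasureTheory Filter Set Topology
open scoped ENNReal
open Literature.MathematicalPhysics.KineticTheory Literature.Analysis.FluidPDE

/-- The radial profile of the cone kernel on `ℝ³`. -/
def coneR3 (r : ℝ) (v : EuclideanSpace ℝ (Fin 3)) : ℝ :=
  3 / (Real.pi * r ^ 3) * max (1 - ‖v‖ / r) 0

/-- The kernel on `ℝ³` vanishes outside the ball of radius `r`. -/
theorem coneR3_eq_zero {r : ℝ} (hr : 0 < r) {v : EuclideanSpace ℝ (Fin 3)} (hv : r ≤ ‖v‖) : coneR3 r v = 0 := by
  unfold coneR3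
  rw [max_eq_right, mul_zero]
  rw [sub_nonpos, le_div_iff₀ hr, one_mul]
  exact hv

/-- Step D/E: the whole-space integral of the cone kernel on `ℝ³` is `1`. -/
theorem integral_coneR3 {r : ℝ} (hr : 0 < r) : ∫ v, coneR3 r v = 1 := by
  have hrad := integral_fun_norm_addHaar (volume : Measure (EuclideanSpace ℝ (Fin 3)))
    (fun y : ℝ => 3 / (Real.pi * r ^ 3) * max (1 - y / r) 0)
  simp only [finrank_euclideanSpace_fin] at hrad
  change ∫ v, 3 / (Real.pi * r ^ 3) * max (1 - ‖v‖ / r) 0 = 1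
  rw [hrad]
  have hball : (volume : Measure (EuclideanSpace ℝ (Fin 3))).real (Metric.ball 0 1) = Real.pi * 4 / 3 := by
    rw [measureReal_def, EuclideanSpace.volume_ball_fin_three]
    rw [ENNReal.ofReal_one, one_pow, one_mul, ENNReal.toReal_ofReal (by positivity)]
  rw [hball]
  -- the one-dimensional integral
  have h1d : ∫ y in Ioi (0 : ℝ), y ^ (3 - 1) • (3 / (Real.pi * r ^ 3) * max (1 - y / r) 0) =
      3 / (Real.pi * r ^ 3) * (r ^ 3 / 12) := by
    have hsplit : ∫ y in Ioi (0 : ℝ), y ^ (3 - 1) • (3 / (Real.pi * r ^ 3) * max (1 - y / r) 0) =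
        ∫ y in Ioc (0 : ℝ) r, 3 / (Real.pi * r ^ 3) * (y ^ 2 * (1 - y / r)) := by
      rw [← Set.Ioc_union_Ioi_eq_Ioi hr.le, setIntegral_union (Set.Ioc_disjoint_Ioi le_rfl) measurableSet_Ioi]
      · have hzero : ∫ y in Ioi r, y ^ (3 - 1) • (3 / (Real.pi * r ^ 3) * max (1 - y / r) 0) = 0 := by
          refine setIntegral_eq_zero_of_forall_eq_zero fun y hy => ?_
          have : max (1 - y / r) 0 = 0 := by
            rw [max_eq_right]
            rw [sub_nonpos, le_div_iff₀ hr, one_mul]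
            exact le_of_lt hy
          rw [this, mul_zero, smul_zero]
        rw [hzero, add_zero]
        refine setIntegral_congr_fun measurableSet_Ioc fun y hy => ?_
        have : max (1 - y / r) 0 = 1 - y / r := by
          rw [max_eq_left]
          rw [sub_nonneg, div_le_one hr]
          exact hy.2
        rw [this, smul_eq_mul]
        ring
      · exact (Continuous.integrableOn_Icc (by fun_prop)).mono_set Set.Ioc_subset_Icc_self
      · refine IntegrableOn.congr_fun (f := fun _ => (0 : ℝ)) integrableOn_zero (fun y hy => ?_) measurableSet_Ioi
        have : max (1 - y / r) 0 = 0 := by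
          rw [max_eq_right]
          rw [sub_nonpos, le_div_iff₀ hr, one_mul]
          exact le_of_lt hy
        rw [this, mul_zero, smul_zero]
    rw [hsplit, integral_const_mul]
    congr 1
    rw [← intervalIntegral.integral_of_le hr.le]
    have hf : (fun y : ℝ => y ^ 2 * (1 - y / r)) = fun y => y ^ 2 - y ^ 3 / r := by
      funext y
      ring
    rw [hf, intervalIntegral.integral_sub ((continuous_pow 2).intervalIntegrable _ _)
      (((continuous_pow 3).div_const r).intervalIntegrable _ _), integral_pow,
      intervalIntegral.integral_div, integral_pow]
    field_simp
    ring
  rw [h1d]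
  simp only [nsmul_eq_mul, smul_eq_mul]
  field_simp
  ring

/-- Step C: `ℝ³` as `Fin 3 → ℝ` versus `EuclideanSpace`. -/
theorem integral_coneR3_toLp (r : ℝ) :
    ∫ a : Fin 3 → ℝ, coneR3 r (WithLp.toLp 2 a) = ∫ v, coneR3 r v := by
  have hemb : MeasurableEmbedding (@WithLp.toLp 2 (Fin 3 → ℝ)) :=
    (MeasurableEquiv.toLp 2 (Fin 3 → ℝ)).measurableEmbedding
  exact (PiLp.volume_preserving_toLp (Fin 3)).integral_comp hemb (coneR3 r)

/-- The fundamental cube `(-1/2, 1/2]³ ⊂ ℝ³`. -/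
def cube : Set (Fin 3 → ℝ) := Set.univ.pi fun _ => Ioc (-(1 / 2 : ℝ)) (-(1 / 2 : ℝ) + 1)

/-- The fundamental cube is measurable. -/
theorem measurableSet_cube : MeasurableSet cube := MeasurableSet.univ_pi fun _ => measurableSet_Ioc

/-- Step B: off the cube the kernel (of radius `r ≤ 1/2`) vanishes. -/
theorem coneR3_toLp_eq_zero_of_not_mem {r : ℝ} (hr : 0 < r) (hr2 : r ≤ 1 / 2) {a : Fin 3 → ℝ} (ha : a ∉ cube) :
    coneR3 r (WithLp.toLp 2 a) = 0 := by
  refine coneR3_eq_zero hr ?_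
  simp only [cube, Set.mem_univ_pi, not_forall, Set.mem_Ioc, not_and_or, not_lt, not_le] at ha
  obtain ⟨i, hi⟩ := ha
  have hai : 1 / 2 ≤ |a i| := by
    rcases hi with h | h
    · rw [abs_of_nonpos (by linarith)]
      linarith
    · rw [abs_of_pos (by linarith)]
      linarith
  calc r ≤ 1 / 2 := hr2
    _ ≤ |a i| := hai
    _ = ‖(WithLp.toLp 2 a : EuclideanSpace ℝ (Fin 3)) i‖ := by simp
    _ ≤ ‖(WithLp.toLp 2 a : EuclideanSpace ℝ (Fin 3))‖ := PiLp.norm_apply_le _ i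

/-- The covering map of the fundamental cube onto `𝕋³`. -/
def coverMap (a : Fin 3 → ℝ) : T3 := fun i => ((a i : ℝ) : UnitAddCircle)

/-- The covering map of the cube is measure-preserving from Lebesgue on `(-1/2,1/2]³` to the Haar probability
measure of `𝕋³` (coordinatewise `UnitAddCircle.measurePreserving_mk`, assembled by `measurePreserving_pi`). -/
theorem measurePreserving_coverMap :
    MeasurePreserving coverMap (Measure.pi fun _ : Fin 3 => (volume : Measure ℝ).restrict (Ioc (-(1 / 2 : ℝ)) (-(1 / 2 : ℝ) + 1)))
      (volume : Measure T3) := by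
  rw [volume_pi]
  exact measurePreserving_pi _ _ fun _ => UnitAddCircle.measurePreserving_mk (-(1 / 2 : ℝ))

/-- On the cube, `reprSym ∘ coverMap = toLp`. -/
theorem reprSym_coverMap {a : Fin 3 → ℝ} (ha : a ∈ cube) : Torus.reprSym (coverMap a) = WithLp.toLp 2 a := by
  unfold Torus.reprSym coverMap
  congr 1
  funext i
  exact AddCircle.equivIoc_coe_of_mem (ha i (Set.mem_univ i))

/-- Step A–E assembled: **the cone kernel is a probability density on `𝕋³`** for `0 < r ≤ 1/2`. -/
theorem coneMass_eq_one {r : ℝ} (hr : 0 < r) (hr2 : r ≤ 1 / 2) : coneMass r = 1 := by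
  set G : T3 → ℝ := fun w => 3 / (Real.pi * r ^ 3) * max (1 - ‖Torus.reprSym w‖ / r) 0 with hGdef
  have hG : Measurable G :=
    measurable_const.mul ((measurable_const.sub (Torus.measurable_reprSym.norm.div_const r)).max measurable_const)
  have hA : coneMass r = ∫ a, G (coverMap a) ∂(Measure.pi fun _ : Fin 3 =>
      (volume : Measure ℝ).restrict (Ioc (-(1 / 2 : ℝ)) (-(1 / 2 : ℝ) + 1))) := by
    rw [← integral_map measurePreserving_coverMap.measurable.aemeasurable, measurePreserving_coverMap.map_eq]
    · rfl
    · rw [measurePreserving_coverMap.map_eq]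
      exact hG.aestronglyMeasurable
  rw [hA, ← Measure.restrict_pi_pi, ← volume_pi]
  change ∫ a in cube, G (coverMap a) = 1
  have hB : ∫ a in cube, G (coverMap a) = ∫ a in cube, coneR3 r (WithLp.toLp 2 a) := by
    refine setIntegral_congr_fun measurableSet_cube fun a ha => ?_
    simp only [hGdef, coneR3, reprSym_coverMap ha]
  rw [hB, setIntegral_eq_integral_of_forall_compl_eq_zero fun a ha => coneR3_toLp_eq_zero_of_not_mem hr hr2 ha,
    integral_coneR3_toLp, integral_coneR3 hr]


/-- **Sharper first-moment point** (`0 < r ≤ 1/2`): every configuration of `n ≥ 1` points has a centre of mollified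
density at least `1` — the Haar average of `x₀ ↦ mollDensity r w x₀` is EXACTLY the mass `1` (`coneMass_eq_one`). -/
theorem exists_one_le_mollDensity {r : ℝ} (hr : 0 < r) (hr2 : r ≤ 1 / 2) {n : ℕ} (hn : n ≠ 0)
    (w : Config n (Fin 3) T3) : ∃ x₀ : T3, 1 ≤ mollDensity r w x₀ := by
  have hci : ∀ i : Fin n, Integrable (fun x₀ : T3 => cone r (w i).1 x₀) volume := by
    intro i
    have hmeas : Measurable fun x₀ : T3 => cone r (w i).1 x₀ := by
      have : (fun x₀ : T3 => cone r (w i).1 x₀) =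
          (fun v : T3 => 3 / (Real.pi * r ^ 3) * max (1 - ‖Torus.reprSym v‖ / r) 0) ∘ fun x₀ => (w i).1 - x₀ := by
        funext x₀
        rfl
      rw [this]
      exact (measurable_coneProfile r).comp (measurable_const.sub measurable_id)
    refine Integrable.of_bound hmeas.aestronglyMeasurable (3 / (Real.pi * r ^ 3)) (ae_of_all _ fun x₀ => ?_)
    rw [Real.norm_eq_abs, abs_of_nonneg (cone_nonneg hr _ _)]
    exact cone_le hr _ _
  have hmi : Integrable (fun x₀ : T3 => mollDensity r w x₀) volume := by
    have : (fun x₀ : T3 => mollDensity r w x₀) = fun x₀ => (n : ℝ)⁻¹ * ∑ i, cone r (w i).1 x₀ :=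
      funext fun x₀ => mollDensity_eq r w x₀
    rw [this]
    exact (integrable_finsetSum _ fun i _ => hci i).const_mul _
  have havg : ∫ x₀, mollDensity r w x₀ = 1 := by
    simp_rw [mollDensity_eq]
    rw [integral_const_mul, integral_finsetSum _ fun i _ => hci i]
    simp_rw [integral_cone, coneMass_eq_one hr hr2]
    rw [Finset.sum_const, Finset.card_univ, Fintype.card_fin, nsmul_eq_mul, mul_one,
      inv_mul_cancel₀ (by exact_mod_cast hn)]
  obtain ⟨x₀, hx₀⟩ := exists_integral_le hmi
  exact ⟨x₀, havg ▸ hx₀⟩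

end Summit.AtomisticToContinuum.HydrodynamicLimit.Theorems.DensityCapNegative

end
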